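/- Free-seat work of EXTRA WIDTH SEAT `ym-line-cbag-p1-w5` (prover-ym-line-cbag-p1-w5-g3-0), route `EguchiKawaiDirectionLadder`
(ideator ym-idea-2, LINE 8), crux `TripleSmallBallMargin` (stmt-QuantumFields-27724), LAST MILE (LEAD's ask «blockFactor_le»): the
PER-BLOCK FACTOR BOUND.  After the one-level decoupling (`symFibre_decoupled`) every labelled block `c` of size `n` contributes
`VdM_c · min(ρ_c², ψ_c)` with `VdM_c = ∏_{a<b} |d(ι_c a) − d(ι_c b)|²`, `ρ_c = blockRigidityMeasure …`, `ψ_c = blockPairMeasure …`.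
This file prices it: on a GOOD block (`n ≥ n₀`, `n ≥ 6q`, `K·N·t ≤ n`) by E_rob / Ψ_rob (width seat w3's `RankRobust.entrywiseRigidity_robust`,
`RankRobust.pairSmallBall_robust`) transported to the block (`BlockPlug`) and the LEAD's `blockPricing_le`, giving
`exp((3/2)C(n,2)(log t + log(N/n)) + C(n,2)A₀ + n²A₁ − (3/2)η n² log t + 5qn·log 100 − 10qn·log t)`; on any block by the trivial
`4^{C(n,2)}`.  The exponent is LITERALLY the LEAD's `blockLog` (MarginBookkeepingSpec).  ROUTE-INDEPENDENT bookkeeping; nothing here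
bears on the Yang–Mills mass gap. -/
import Summits.QuantumFields.YangMills.Theorems.EguchiKawaiDirectionLadderSymFibreDecoupled
import Summits.QuantumFields.YangMills.Theorems.EguchiKawaiDirectionLadderBlockPricing
import Summits.QuantumFields.YangMills.Theorems.EguchiKawaiDirectionLadderRobustRigidityPair
import Summits.QuantumFields.YangMills.Theorems.EguchiKawaiDirectionLadderBlockPlug
import Summits.QuantumFields.YangMills.Theorems.EguchiKawaiDirectionLadderPairLawBridge
import HarnessLib

/-!
# Route `EguchiKawaiDirectionLadder`, crux `TripleSmallBallMargin`: the per-block factor bound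

Block `c` of a labelling `ℓ : Fin N → Fin (m+1)`, `S_c = {ℓ = c}`, `n = #S_c`, `ι = S_c.orderEmbOfFin`, phases `d : Fin N → ℂ` (unit modulus),
budgets `N t ≤ β_ρ, β_ψ ≤ K N t`, rank slacks `r_ρ ≤ 2q`, `r_ψ ≤ 6q`.

* `goodExponent_le` — the pure-real comparison of the priced exponent with the target exponent;
* `blockFactor_trivial_le` — `VdM_c · min(ρ_c², ψ_c) ≤ 4^{C(n,2)} = exp(C(n,2)·log 4)` (always);
* `blockFactor_good_le` — on a good block, `VdM_c · min(ρ_c², ψ_c) ≤ exp(GOOD)` given E_rob / Ψ_rob at size `n` (hypotheses in the exact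
  shape of w3's `RankRobust.entrywiseRigidity_robust` / `RankRobust.pairSmallBall_robust` at `N := n`);
* `blockFactor_bound` — both combined behind the `if` of `blockLog`, with w3's constants discharged (`∃ κ ≥ 1, C_ρ, C_ψ ≥ 0, n₁, ∀ …`), so that
  the MAIN file only chooses `K ≥ 1`, `n₀ ≥ n₁`, `A₀ ≥ log κ + (3/2) log K`, `A₁ ≥ C_ρ + C_ψ/2`.

HONEST FRAMING: bookkeeping; the estimates are w3's/LEAD's landed theorems.  The route bears on the barrier-ledger fact `EguchiKawaiBreakdown`;
the Yang–Mills mass gap is NOT touched.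
-/

set_option autoImplicit false

noncomputable section

open MeasureTheory Finset
open scoped Matrix ENNReal
open Literature.Barriers.QuantumFields
open Literature.MathematicalPhysics.QuantumFieldTheory (haarProbability)

namespace Summit.QuantumFields.YangMills.Theorems.EguchiKawaiDirectionLadder

namespace BlockFactor

/-! ### §1 Pure-real exponent comparison -/

/-- **The exponent comparison.**  With `L = log t ≤ 0`, `Lr = log(N/n) ≥ 0`, `lK = log K ≥ 0`, block log-budgets `ℓρ, ℓψ ∈ [L, L + Lr + lK]`,
`ℓρ, ℓψ ≤ 0`, rank slacks `rρ ≤ 2q`, `rψ ≤ 6q`, pair count `P ≥ 0`: the priced exponent is at most the target exponent. -/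
theorem goodExponent_le {nn P L Lr lK lκ ℓρ ℓψ Cρ Cψ η q rρ rψ : ℝ}
    (hnn : 0 ≤ nn) (hP : 0 ≤ P) (hη : 0 ≤ η) (hq : 0 ≤ q) (hrρ : rρ ≤ 2 * q) (hrψ : rψ ≤ 6 * q)
    (hρ1 : ℓρ ≤ L + Lr + lK) (hρ2 : L ≤ ℓρ) (hρ0 : ℓρ ≤ 0) (hψ1 : ℓψ ≤ L + Lr + lK) (hψ2 : L ≤ ℓψ) (hψ0 : ℓψ ≤ 0) :
    nn ^ 2 * (Cρ - η * ℓρ) + rρ * nn * (Real.log 100 - 2 * ℓρ) +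
        (1 / 2) * (nn ^ 2 * (Cψ - η * ℓψ) + rψ * nn * (Real.log 100 - 2 * ℓψ)) + P * (lκ + ℓρ) + (P / 2) * ℓψ ≤
      (3 / 2) * P * (L + Lr) + P * (lκ + (3 / 2) * lK) + nn ^ 2 * (Cρ + Cψ / 2) - (3 / 2) * η * nn ^ 2 * L +
        5 * q * nn * Real.log 100 - 10 * q * nn * L := by
  have hlog100 : 0 ≤ Real.log 100 := Real.log_nonneg (by norm_num)
  have h1 : P * ℓρ ≤ P * (L + Lr + lK) := mul_le_mul_of_nonneg_left hρ1 hP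
  have h2 : (P / 2) * ℓψ ≤ (P / 2) * (L + Lr + lK) := mul_le_mul_of_nonneg_left hψ1 (by positivity)
  have h3 : η * nn ^ 2 * L ≤ η * nn ^ 2 * ℓρ := mul_le_mul_of_nonneg_left hρ2 (by positivity)
  have h4 : η * nn ^ 2 * L ≤ η * nn ^ 2 * ℓψ := mul_le_mul_of_nonneg_left hψ2 (by positivity)
  have hbρ : 0 ≤ Real.log 100 - 2 * ℓρ := by linarith
  have hbψ : 0 ≤ Real.log 100 - 2 * ℓψ := by linarith
  have h5 : rρ * nn * (Real.log 100 - 2 * ℓρ) ≤ 2 * q * nn * (Real.log 100 - 2 * ℓρ) :=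
    mul_le_mul_of_nonneg_right (mul_le_mul_of_nonneg_right hrρ hnn) hbρ
  have h6 : 2 * q * nn * (Real.log 100 - 2 * ℓρ) ≤ 2 * q * nn * (Real.log 100 - 2 * L) :=
    mul_le_mul_of_nonneg_left (by linarith) (by positivity)
  have h7 : rψ * nn * (Real.log 100 - 2 * ℓψ) ≤ 6 * q * nn * (Real.log 100 - 2 * ℓψ) :=
    mul_le_mul_of_nonneg_right (mul_le_mul_of_nonneg_right hrψ hnn) hbψ
  have h8 : 6 * q * nn * (Real.log 100 - 2 * ℓψ) ≤ 6 * q * nn * (Real.log 100 - 2 * L) :=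
    mul_le_mul_of_nonneg_left (by linarith) (by positivity)
  nlinarith [h1, h2, h3, h4, h5, h6, h7, h8]

/-! ### §2 The trivial bound -/

variable {N m : ℕ}

/-- `∏_{a<b} |u a − u b|² ≤ 4^{C(n,2)}` for unit-modulus `u`. -/
theorem prod_norm_sub_sq_le_four_pow {n : ℕ} (u : Fin n → ℂ) (hu : ∀ a, ‖u a‖ = 1) :
    ∏ a : Fin n, ∏ b ∈ Ioi a, ‖u a - u b‖ ^ 2 ≤ (4 : ℝ) ^ n.choose 2 := by
  have hle : ∀ a b, ‖u a - u b‖ ^ 2 ≤ 4 := by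
    intro a b
    have h : ‖u a - u b‖ ≤ 2 := by
      calc ‖u a - u b‖ ≤ ‖u a‖ + ‖u b‖ := norm_sub_le _ _
        _ = 2 := by rw [hu a, hu b]; norm_num
    nlinarith [norm_nonneg (u a - u b)]
  calc ∏ a : Fin n, ∏ b ∈ Ioi a, ‖u a - u b‖ ^ 2 ≤ ∏ a : Fin n, ∏ b ∈ Ioi a, (4 : ℝ) :=
        prod_le_prod (fun a _ => prod_nonneg fun b _ => by positivity) fun a _ =>
          prod_le_prod (fun b _ => by positivity) fun b _ => hle a b
    _ = (4 : ℝ) ^ n.choose 2 := by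
        simp_rw [prod_const, prod_pow_eq_pow_sum, sum_card_Ioi_eq_choose_two]

/-- `4^{C(n,2)} = exp((n(n−1)/2)·log 4)`. -/
theorem four_pow_choose_two_eq_exp (n : ℕ) :
    (4 : ℝ) ^ n.choose 2 = Real.exp (((n : ℝ) * ((n : ℝ) - 1) / 2) * Real.log 4) := by
  rw [← Nat.cast_choose_two, Real.exp_nat_mul, Real.exp_log (by norm_num : (0 : ℝ) < 4)]

/-- **The trivial per-block bound**: `VdM_c · min(ρ_c², ψ_c) ≤ 4^{C(n,2)}` (each squared chord is `≤ 4`, the pair measure is `≤ 1`). -/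
theorem blockFactor_trivial_le (ℓ : Fin N → Fin (m + 1)) (d : Fin N → ℂ) (hd : ∀ i, ‖d i‖ = 1) (c : Fin (m + 1)) {n : ℕ}
    (hn : (univ.filter fun i => ℓ i = c).card = n) (βρ βψ : ℝ) (rρ rψ : ℕ) :
    ENNReal.ofReal (∏ a : Fin n, ∏ b ∈ Ioi a,
        ‖d ((univ.filter fun i => ℓ i = c).orderEmbOfFin hn a) - d ((univ.filter fun i => ℓ i = c).orderEmbOfFin hn b)‖ ^ 2) *
      min (blockRigidityMeasure ℓ d c βρ rρ * blockRigidityMeasure ℓ d c βρ rρ) (blockPairMeasure ℓ c βψ rψ) ≤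
    ENNReal.ofReal (Real.exp (((n : ℝ) * ((n : ℝ) - 1) / 2) * Real.log 4)) := by
  have hV := prod_norm_sub_sq_le_four_pow (fun a => d ((univ.filter fun i => ℓ i = c).orderEmbOfFin hn a)) fun a => hd _
  have hψ1 : blockPairMeasure ℓ c βψ rψ ≤ 1 := by
    unfold blockPairMeasure; exact prob_le_one
  calc _ ≤ ENNReal.ofReal ((4 : ℝ) ^ n.choose 2) * 1 :=
        mul_le_mul (ENNReal.ofReal_le_ofReal hV) ((min_le_right _ _).trans hψ1) bot_le bot_le
    _ = _ := by rw [mul_one, four_pow_choose_two_eq_exp]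

/-! ### §3 The good-block bound -/

/-- **The good-block bound.**  On a block with `6q ≤ n`, `K·N·t ≤ n` and both rank-robust inputs available at size `n`, for budgets
`N t ≤ β_ρ, β_ψ ≤ K N t`, rank slacks `r_ρ ≤ 2q`, `r_ψ ≤ 6q`, and any `A₀ ≥ log κ + (3/2) log K`, `A₁ ≥ C_ρ + C_ψ/2`:
`VdM_c · min(ρ_c², ψ_c) ≤ exp((3/2)C(n,2)(log t + log(N/n)) + C(n,2)A₀ + n²A₁ − (3/2)η n² log t + 5qn log 100 − 10qn log t)`. -/
theorem blockFactor_good_le {n : ℕ} {κ Cρ Cψ η A₀ A₁ K : ℝ} (hκ : 1 ≤ κ) (hη : 0 ≤ η) (hK : 1 ≤ K)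
    (hE : ∀ t : ℝ, 0 < t → t ≤ 1 → ∀ (D : UN n) (u : Fin n → ℂ), (D : Matrix (Fin n) (Fin n) ℂ) = Matrix.diagonal u →
      ∀ s : ℕ, s ≤ n →
        haarProbability (UN n) {W : UN n | ∃ R : Matrix (Fin n) (Fin n) ℂ, R.rank ≤ s ∧
            frobSq ((D : Matrix (Fin n) (Fin n) ℂ) * (W : Matrix (Fin n) (Fin n) ℂ) -
              (W : Matrix (Fin n) (Fin n) ℂ) * (D : Matrix (Fin n) (Fin n) ℂ) - R) ≤ (n : ℝ) * t} ≤
          ENNReal.ofReal (Real.exp ((n : ℝ) ^ 2 * (Cρ - η * Real.log t) + (s : ℝ) * n * (Real.log 100 - 2 * Real.log t)) *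
            ∏ j : Fin n, ∏ k ∈ Ioi j, pairFactor (κ * t) (‖u j - u k‖ ^ 2)))
    (hΨ : ∀ t : ℝ, 0 < t → t ≤ 1 → ∀ s : ℕ, s ≤ n →
      ekHaar 2 n {U : EKConfig 2 n | ∃ R : Matrix (Fin n) (Fin n) ℂ, R.rank ≤ s ∧ frobSq (ekComm U 0 1 - R) ≤ (n : ℝ) * t} ≤
        ENNReal.ofReal (Real.exp ((n : ℝ) ^ 2 * (Cψ - η * Real.log t) + (s : ℝ) * n * (Real.log 100 - 2 * Real.log t)) *
          t ^ n.choose 2))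
    (hA₀ : Real.log κ + (3 / 2) * Real.log K ≤ A₀) (hA₁ : Cρ + Cψ / 2 ≤ A₁)
    (ℓ : Fin N → Fin (m + 1)) (d : Fin N → ℂ) (hd : ∀ i, ‖d i‖ = 1) (c : Fin (m + 1))
    (hn : (univ.filter fun i => ℓ i = c).card = n)
    {q rρ rψ : ℕ} (hrρ : rρ ≤ 2 * q) (hrψ : rψ ≤ 6 * q) (h6q : 6 * q ≤ n)
    {t βρ βψ : ℝ} (ht : 0 < t) (hβρ1 : (N : ℝ) * t ≤ βρ) (hβρ2 : βρ ≤ K * N * t)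
    (hβψ1 : (N : ℝ) * t ≤ βψ) (hβψ2 : βψ ≤ K * N * t) (hKn : K * N * t ≤ n) :
    ENNReal.ofReal (∏ a : Fin n, ∏ b ∈ Ioi a,
        ‖d ((univ.filter fun i => ℓ i = c).orderEmbOfFin hn a) - d ((univ.filter fun i => ℓ i = c).orderEmbOfFin hn b)‖ ^ 2) *
      min (blockRigidityMeasure ℓ d c βρ rρ * blockRigidityMeasure ℓ d c βρ rρ) (blockPairMeasure ℓ c βψ rψ) ≤
    ENNReal.ofReal (Real.exp (
      (3 / 2) * ((n : ℝ) * ((n : ℝ) - 1) / 2) * (Real.log t + Real.log ((N : ℝ) / n)) +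
        ((n : ℝ) * ((n : ℝ) - 1) / 2) * A₀ + (n : ℝ) ^ 2 * A₁ - (3 / 2) * η * (n : ℝ) ^ 2 * Real.log t +
        5 * q * n * Real.log 100 - 10 * q * n * Real.log t)) := by
  classical
  -- sizes
  have hnN : n ≤ N := by
    rw [← hn]; exact (card_filter_le _ _).trans (by simp)
  rcases Nat.eq_zero_or_pos n with hn0 | hnpos
  · -- empty block: everything is trivial
    subst hn0
    have hψ1 : blockPairMeasure ℓ c βψ rψ ≤ 1 := by unfold blockPairMeasure; exact prob_le_one
    have hV : ENNReal.ofReal (∏ a : Fin 0, ∏ b ∈ Ioi a,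
        ‖d ((univ.filter fun i => ℓ i = c).orderEmbOfFin hn a) - d ((univ.filter fun i => ℓ i = c).orderEmbOfFin hn b)‖ ^ 2) = 1 := by
      simp
    rw [hV, one_mul]
    refine ((min_le_right _ _).trans hψ1).trans ?_
    rw [← ENNReal.ofReal_one]
    refine ENNReal.ofReal_le_ofReal ?_
    have : Real.exp 0 = 1 := Real.exp_zero
    rw [← this]
    refine Real.exp_le_exp.mpr (le_of_eq ?_)
    push_cast; ring
  have hnR : (0 : ℝ) < n := by exact_mod_cast hnpos
  have hNpos : (0 : ℝ) < N := lt_of_lt_of_le hnR (by exact_mod_cast hnN)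
  have hNn : (1 : ℝ) ≤ (N : ℝ) / n := by
    rw [le_div_iff₀ hnR, one_mul]; exact_mod_cast hnN
  -- budgets per unit: τ = β / n ∈ [t, K (N/n) t] ⊆ (0, 1]
  set τρ : ℝ := βρ / n with hτρ
  set τψ : ℝ := βψ / n with hτψ
  have hNt : 0 < (N : ℝ) * t := by positivity
  have hτρ0 : 0 < τρ := div_pos (lt_of_lt_of_le hNt hβρ1) hnR
  have hτψ0 : 0 < τψ := div_pos (lt_of_lt_of_le hNt hβψ1) hnR
  have hτρ1 : τρ ≤ 1 := by
    rw [hτρ, div_le_one hnR]; exact hβρ2.trans hKn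
  have hτψ1 : τψ ≤ 1 := by
    rw [hτψ, div_le_one hnR]; exact hβψ2.trans hKn
  have hnτρ : (n : ℝ) * τρ = βρ := by rw [hτρ]; field_simp
  have hnτψ : (n : ℝ) * τψ = βψ := by rw [hτψ]; field_simp
  -- log bounds
  have hKpos : 0 < K := lt_of_lt_of_le one_pos hK
  have hlogK : 0 ≤ Real.log K := Real.log_nonneg hK
  have hlogκ : 0 ≤ Real.log κ := Real.log_nonneg hκ
  have hLr : 0 ≤ Real.log ((N : ℝ) / n) := Real.log_nonneg hNn
  have hup : ∀ {β : ℝ}, β ≤ K * N * t → (N : ℝ) * t ≤ β →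
      Real.log (β / n) ≤ Real.log t + Real.log ((N : ℝ) / n) + Real.log K ∧ Real.log t ≤ Real.log (β / n) := by
    intro β hβ2 hβ1
    have hβ0 : 0 < β := lt_of_lt_of_le hNt hβ1
    constructor
    · have h1 : β / n ≤ K * ((N : ℝ) / n) * t := by
        rw [div_le_iff₀ hnR]
        calc β ≤ K * N * t := hβ2
          _ = K * ((N : ℝ) / n) * t * n := by field_simp
      calc Real.log (β / n) ≤ Real.log (K * ((N : ℝ) / n) * t) := Real.log_le_log (div_pos hβ0 hnR) h1
        _ = Real.log K + Real.log ((N : ℝ) / n) + Real.log t := by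
            rw [Real.log_mul (by positivity) ht.ne', Real.log_mul hKpos.ne' (by positivity)]
        _ = _ := by ring
    · refine Real.log_le_log ht ?_
      rw [le_div_iff₀ hnR]
      calc t * n ≤ t * N := mul_le_mul_of_nonneg_left (by exact_mod_cast hnN) ht.le
        _ = N * t := mul_comm _ _
        _ ≤ β := hβ1
  obtain ⟨hρ1, hρ2⟩ := hup hβρ2 hβρ1
  obtain ⟨hψ1', hψ2'⟩ := hup hβψ2 hβψ1
  have hρ0 : Real.log τρ ≤ 0 := Real.log_nonpos hτρ0.le hτρ1
  have hψ0 : Real.log τψ ≤ 0 := Real.log_nonpos hτψ0.le hτψ1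
  -- the block equivalence and the phases on `Fin n`
  obtain ⟨e, he⟩ := BlockPhases.exists_blockEquiv ℓ c hn
  set ι : Fin n → Fin N := fun a => (univ.filter fun i => ℓ i = c).orderEmbOfFin hn a with hι
  set u : Fin n → ℂ := d ∘ ι with hu
  have hu1 : ∀ a, ‖u a‖ = 1 := BlockPhases.norm_comp_eq_one d hd ι
  set x : Fin n → Fin n → ℝ := fun j k => ‖u j - u k‖ ^ 2 with hx
  have hx0 : ∀ j k, 0 ≤ x j k := fun j k => by positivity
  -- ρ: transport to `UN n` and apply the rigidity input at `τρ`
  set Dι : UN n := ⟨Matrix.diagonal u,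
    (Literature.MathematicalPhysics.QuantumLattice.diagonal_mem_unitaryGroup_iff u).mpr hu1⟩ with hDι
  have hDmat : (Dι : Matrix (Fin n) (Fin n) ℂ) = Matrix.diagonal u := rfl
  have hrρn : rρ ≤ n := hrρ.trans ((Nat.mul_le_mul_right q (by norm_num : 2 ≤ 6)).trans h6q)
  have hrψn : rψ ≤ n := hrψ.trans h6q
  set aρ : ℝ := Real.exp ((n : ℝ) ^ 2 * (Cρ - η * Real.log τρ) + (rρ : ℝ) * n * (Real.log 100 - 2 * Real.log τρ)) with haρ
  have hρ : blockRigidityMeasure ℓ d c βρ rρ ≤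
      ENNReal.ofReal (aρ * ∏ j : Fin n, ∏ k ∈ Ioi j, pairFactor (κ * τρ) (x j k)) := by
    have heq := BlockPlug.haar_block_rankRobustLink_eq (fun i => ℓ i = c) e ι he d rρ βρ
    have hin := hE τρ hτρ0 hτρ1 Dι u hDmat rρ hrρn
    rw [hnτρ] at hin
    unfold blockRigidityMeasure
    rw [heq]
    simpa only [hDmat, frobSq] using hin
  -- ψ: transport to `UN n`, then to `ekHaar 2 n`, and apply the pair input at `τψ`
  set aψ : ℝ := Real.exp ((n : ℝ) ^ 2 * (Cψ - η * Real.log τψ) + (rψ : ℝ) * n * (Real.log 100 - 2 * Real.log τψ)) with haψ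
  have hψ : blockPairMeasure ℓ c βψ rψ ≤ ENNReal.ofReal (aψ * τψ ^ n.choose 2) := by
    have heq := (BlockPlug.haarPair_block_rankRobustComm_eq (fun i => ℓ i = c) e rψ βψ).trans
      (PairLawBridge.prod_rankRobustCommutator_eq_ekHaar_two rψ βψ)
    have hin := hΨ τψ hτψ0 hτψ1 rψ hrψn
    rw [hnτψ] at hin
    unfold blockPairMeasure
    rw [heq]
    exact hin
  -- pricing
  have haρ0 : 0 ≤ aρ := (Real.exp_pos _).le
  have haψ0 : 0 ≤ aψ := (Real.exp_pos _).le
  have hκτ : 0 ≤ κ * τρ := mul_nonneg (zero_le_one.trans hκ) hτρ0.le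
  have hprice := blockPricing_le x hx0 haρ0 haψ0 hκτ hτψ0.le hρ hψ
  refine hprice.trans (ENNReal.ofReal_le_ofReal ?_)
  -- everything as one exponential
  have hκτpos : 0 < κ * τρ := mul_pos (lt_of_lt_of_le one_pos hκ) hτρ0
  have hsqrt : Real.sqrt aψ = Real.exp (((n : ℝ) ^ 2 * (Cψ - η * Real.log τψ) +
      (rψ : ℝ) * n * (Real.log 100 - 2 * Real.log τψ)) / 2) := by
    rw [haψ, ← Real.exp_half]
  have hpow1 : (κ * τρ) ^ n.choose 2 = Real.exp ((n.choose 2 : ℕ) * Real.log (κ * τρ)) := by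
    rw [Real.exp_nat_mul, Real.exp_log hκτpos]
  have hpow2 : Real.sqrt (τψ ^ n.choose 2) = Real.exp ((n.choose 2 : ℕ) * Real.log τψ / 2) := by
    rw [Real.exp_half, Real.exp_nat_mul, Real.exp_log hτψ0]
  rw [hsqrt, hpow1, hpow2, haρ, ← Real.exp_add, ← Real.exp_add, ← Real.exp_add, Real.exp_le_exp, Nat.cast_choose_two,
    Real.log_mul (by positivity) hτρ0.ne']
  have hP : (0 : ℝ) ≤ (n : ℝ) * ((n : ℝ) - 1) / 2 := by
    have : (1 : ℝ) ≤ n := by exact_mod_cast hnpos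
    nlinarith
  have hmain := goodExponent_le (nn := (n : ℝ)) (P := (n : ℝ) * ((n : ℝ) - 1) / 2) (L := Real.log t)
    (Lr := Real.log ((N : ℝ) / n)) (lK := Real.log K) (lκ := Real.log κ) (Cρ := Cρ) (Cψ := Cψ) (η := η)
    (q := (q : ℝ)) (rρ := (rρ : ℝ)) (rψ := (rψ : ℝ)) hnR.le hP hη (by positivity)
    (by exact_mod_cast hrρ) (by exact_mod_cast hrψ) hρ1 hρ2 hρ0 hψ1' hψ2' hψ0
  have hA₀' : ((n : ℝ) * ((n : ℝ) - 1) / 2) * (Real.log κ + (3 / 2) * Real.log K) ≤ ((n : ℝ) * ((n : ℝ) - 1) / 2) * A₀ :=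
    mul_le_mul_of_nonneg_left hA₀ hP
  have hA₁' : (n : ℝ) ^ 2 * (Cρ + Cψ / 2) ≤ (n : ℝ) ^ 2 * A₁ := mul_le_mul_of_nonneg_left hA₁ (by positivity)
  linarith

/-! ### §4 The packaged bound (w3's constants discharged, `blockLog` case split) -/

/-- **The per-block factor bound**: for every `η > 0` there are `κ ≥ 1`, `C_ρ, C_ψ ≥ 0` and `n₁` (from width seat w3's
`RankRobust.entrywiseRigidity_robust` / `RankRobust.pairSmallBall_robust`) such that for every `K ≥ 1`, `n₀ ≥ n₁`, `A₀ ≥ log κ + (3/2) log K`,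
`A₁ ≥ C_ρ + C_ψ/2`, every labelling, unit phases, block `c` of size `n`, `q`, rank slacks `r_ρ ≤ 2q`, `r_ψ ≤ 6q`, and budgets
`N t ≤ β_ρ, β_ψ ≤ K N t` (`t > 0`):
`VdM_c · min(ρ_c², ψ_c) ≤ exp(if n₀ ≤ n ∧ 6q ≤ n ∧ K·N·t ≤ n then GOOD else C(n,2)·log 4)` — LITERALLY `exp(blockLog N q n₀ t K A₀ A₁ η n)`
of the LEAD's margin bookkeeping. -/
theorem blockFactor_bound (η : ℝ) (hη : 0 < η) :
    ∃ κ : ℝ, 1 ≤ κ ∧ ∃ Cρ : ℝ, 0 ≤ Cρ ∧ ∃ Cψ : ℝ, 0 ≤ Cψ ∧ ∃ n₁ : ℕ,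
      ∀ (K A₀ A₁ : ℝ) (n₀ : ℕ), 1 ≤ K → n₁ ≤ n₀ → Real.log κ + (3 / 2) * Real.log K ≤ A₀ → Cρ + Cψ / 2 ≤ A₁ →
      ∀ (N m : ℕ) (ℓ : Fin N → Fin (m + 1)) (d : Fin N → ℂ), (∀ i, ‖d i‖ = 1) →
      ∀ (c : Fin (m + 1)) (n : ℕ) (hn : (univ.filter fun i => ℓ i = c).card = n) (q rρ rψ : ℕ), rρ ≤ 2 * q → rψ ≤ 6 * q →
      ∀ (t βρ βψ : ℝ), 0 < t → (N : ℝ) * t ≤ βρ → βρ ≤ K * N * t → (N : ℝ) * t ≤ βψ → βψ ≤ K * N * t →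
        ENNReal.ofReal (∏ a : Fin n, ∏ b ∈ Ioi a,
            ‖d ((univ.filter fun i => ℓ i = c).orderEmbOfFin hn a) - d ((univ.filter fun i => ℓ i = c).orderEmbOfFin hn b)‖ ^ 2) *
          min (blockRigidityMeasure ℓ d c βρ rρ * blockRigidityMeasure ℓ d c βρ rρ) (blockPairMeasure ℓ c βψ rψ) ≤
        ENNReal.ofReal (Real.exp (
          if n₀ ≤ n ∧ 6 * q ≤ n ∧ K * N * t ≤ n then
            (3 / 2) * ((n : ℝ) * ((n : ℝ) - 1) / 2) * (Real.log t + Real.log ((N : ℝ) / n)) +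
              ((n : ℝ) * ((n : ℝ) - 1) / 2) * A₀ + (n : ℝ) ^ 2 * A₁ - (3 / 2) * η * (n : ℝ) ^ 2 * Real.log t +
              5 * q * n * Real.log 100 - 10 * q * n * Real.log t
          else ((n : ℝ) * ((n : ℝ) - 1) / 2) * Real.log 4)) := by
  obtain ⟨κ, hκ, Cρ, hCρ, N₁, hE⟩ := RankRobust.entrywiseRigidity_robust η hη
  obtain ⟨Cψ, hCψ, N₂, hΨ⟩ := RankRobust.pairSmallBall_robust η hη
  refine ⟨κ, hκ, Cρ, hCρ, Cψ, hCψ, max N₁ N₂, ?_⟩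
  intro K A₀ A₁ n₀ hK hn₁ hA₀ hA₁ N m ℓ d hd c n hn q rρ rψ hrρ hrψ t βρ βψ ht hβρ1 hβρ2 hβψ1 hβψ2
  split_ifs with hgood
  · obtain ⟨hn₀, h6q, hKn⟩ := hgood
    have hN₁ : N₁ ≤ n := (le_max_left _ _).trans (hn₁.trans hn₀)
    have hN₂ : N₂ ≤ n := (le_max_right _ _).trans (hn₁.trans hn₀)
    exact blockFactor_good_le hκ hη.le hK (fun t' ht' ht1' D u hD s hs => hE n hN₁ t' ht' ht1' D u hD s hs)
      (fun t' ht' ht1' s hs => hΨ n hN₂ t' ht' ht1' s hs) hA₀ hA₁ ℓ d hd c hn hrρ hrψ h6q ht hβρ1 hβρ2 hβψ1 hβψ2 hKn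
  · exact blockFactor_trivial_le ℓ d hd c hn βρ βψ rρ rψ

end BlockFactor

end Summit.QuantumFields.YangMills.Theorems.EguchiKawaiDirectionLadder

end
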